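import Summits.PneNP.PneNP.Theorems.ExpanderLinearGeneratorsNoPolyBoundedProofSystem
import Summits.PneNP.PneNP.Theorems.RamseyNotNP.Negative.Sandwich
import Literature.ModelTheory.FiniteModelTheory.ESOProofs

/-!
# Route ExpanderLinearGenerators — the target `NoPolyBoundedProofSystem` and Fagin's programme
(`∃SO` versus complementation)

Helper file for item `stmt-PneNP-0097` (the rank-0 target
`Summit.PneNP.PneNP.Theses.ExpanderLinearGenerators.NoPolyBoundedProofSystem :=
 ¬ HasPolyBoundedProofSystem TAUT`, `NP ≠ coNP` over the tree's classes by
`noPolyBoundedProofSystem_iff_NP_ne_coNP`). With Fagin's theorem PROVED in the tree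
(`Literature.ModelTheory.FiniteModelTheory.fagin_theorem_holds`: over a non-degenerate relational
vocabulary, an isomorphism-closed class of finite structures is `∃SO`-definable iff the language of
its codes is in `NP`), the descriptive-complexity route to the target becomes a kernel-checked
bridge:

* `isESODefinable_compl_of_NP_eq_coNP` — if `NP = coNP` then `∃SO` is closed under
  complementation: the complement (within the finite `ar`-structures) of every isomorphism-closed
  `∃SO`-definable class over a non-degenerate vocabulary is again `∃SO`-definable (Fagin 1974,
  Thm. 9 direction "NP closed under complement ⇒ generalized spectra closed under complement");
* `noPolyBoundedProofSystem_of_not_isESODefinable_compl` — contrapositive bridge INTO the target: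
  ONE isomorphism-closed `∃SO` class (over one non-degenerate vocabulary) whose complement is not
  `∃SO`-definable proves the target. This is the reduction behind Fagin's programme for
  `NP ≠ coNP` (carried out for MONADIC `∃SO` by Fagin 1975 — connectivity — which does not suffice).

Ingredients, all tree theorems: `fagin_theorem_holds`; `isESODefinable_univ` (the class of all
structures, by `⊤`), whence the language of VALID CODES is in `NP`; closure of `NP` under binary
intersection (`RamseyNotNP.Negative.inter_mem_NP`); injectivity of the table encoding
(`Computability.Encoding.encode_injective`), which identifies the code language of the complement
class with (valid codes) ∩ (code language)ᶜ (`toLanguage_compl`).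

What is NOT here: the converse (the target ⇒ some `∃SO` class with non-`∃SO` complement, Fagin's
full equivalence `NP = coNP ↔ ∃SO = ∀SO`), which needs an `NP`-complete problem presented as an
isomorphism-closed class of structures in the tree's table encoding (order-invariant coding of
strings) — not available in the tree.

Sources: R. Fagin, *Generalized first-order spectra and polynomial-time recognizable sets*,
SIAM–AMS Proc. 7 (1974) 43–73, §§2–4 and the closing discussion of complementation; N. Immerman,
*Descriptive Complexity* (1999), Thm. 7.8 and Cor. 7.9; L. Libkin, *Elements of Finite Model
Theory* (2004), Thm. 9.6 and §9.1; S. A. Cook, R. A. Reckhow, JSL 44 (1979), Prop. 1.1.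
-/

set_option linter.dupNamespace false -- `Summit.PneNP.PneNP.…`: summit = sub-problem name (D-0017 single-conjunct layout)

namespace Summit.PneNP.PneNP.Theorems

open Literature.Computability.Complexity Literature.Computability.MetaComplexity
open Literature.Computability.Cryptography Literature.ModelTheory.FiniteModelTheory
open Summit.PneNP.PneNP.Theses.ExpanderLinearGenerators

/-! ### Complement classes and their code languages -/

/-- The complement of an isomorphism-closed class of finite structures is isomorphism-closed.
[cite: Fagin1974, §2] -/
theorem isIsoClosedStr_compl {ar : List ℕ} {C : Set (SNPInstance ar)} (hC : IsIsoClosedStr ar C) :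
    IsIsoClosedStr ar Cᶜ :=
  fun n R π => not_congr (hC n R π)

/-- For an injective coding, the code language of the complement class is
(valid codes) ∩ (code language of the class)ᶜ. [folklore] -/
theorem toLanguage_compl {α : Type} (e : _root_.Computability.Encoding α Bool) (S : Set α) :
    e.toLanguage Sᶜ = e.toLanguage Set.univ ⊓ (e.toLanguage S)ᶜ := by
  ext w
  change w ∈ e.encode '' Sᶜ ↔ w ∈ e.encode '' Set.univ ∧ w ∉ e.encode '' S
  constructor
  · rintro ⟨a, haS, rfl⟩
    refine ⟨⟨a, Set.mem_univ a, rfl⟩, ?_⟩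
    rintro ⟨b, hbS, hba⟩
    exact haS (e.encode_injective hba ▸ hbS)
  · rintro ⟨⟨a, -, rfl⟩, hnot⟩
    exact ⟨a, fun haS => hnot ⟨a, haS, rfl⟩, rfl⟩

/-- The language of VALID CODES of finite `ar`-structures (non-degenerate `ar`) is in `NP`: the class
of all structures is `∃SO`-definable (`isESODefinable_univ`) and Fagin's theorem applies.
[cite: Immerman1999, Thm. 7.8] -/
theorem toLanguage_univ_mem_NP {ar : List ℕ} (har : IsNondegenerateVocab ar) :
    (encodingSNPInstance ar).toLanguage Set.univ ∈ Nondeterministic.NP :=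
  (fagin_theorem_holds ar Set.univ har (isIsoClosedStr_univ ar)).1 (isESODefinable_univ ar)

/-! ### `NP = coNP` closes `∃SO` under complementation -/

/-- **Fagin: if `NP = coNP` then `∃SO` is closed under complementation.** Over a non-degenerate
vocabulary, the complement of an isomorphism-closed `∃SO`-definable class of finite structures is
`∃SO`-definable: its code language is (valid codes) ∩ (codes of the class)ᶜ, an intersection of two
`NP` languages once `NP = coNP`, and Fagin's theorem (tree: `fagin_theorem_holds`) converts back.
[cite: Fagin1974, §4 (complements of generalized spectra)] [cite: Immerman1999, Cor. 7.9] -/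
theorem isESODefinable_compl_of_NP_eq_coNP (hNC : Nondeterministic.NP = coNP) {ar : List ℕ}
    (har : IsNondegenerateVocab ar) {C : Set (SNPInstance ar)} (hC : IsIsoClosedStr ar C)
    (hdef : IsESODefinable ar C) : IsESODefinable ar Cᶜ := by
  have hL : (encodingSNPInstance ar).toLanguage C ∈ Nondeterministic.NP :=
    (fagin_theorem_holds ar C har hC).1 hdef
  have hLc : ((encodingSNPInstance ar).toLanguage C)ᶜ ∈ Nondeterministic.NP := by
    have h' : ((encodingSNPInstance ar).toLanguage C)ᶜ ∈ coNP := by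
      change ((encodingSNPInstance ar).toLanguage C)ᶜᶜ ∈ Nondeterministic.NP
      rwa [compl_compl]
    rwa [← hNC] at h'
  refine (fagin_theorem_holds ar Cᶜ har (isIsoClosedStr_compl hC)).2 ?_
  rw [toLanguage_compl]
  exact RamseyNotNP.Negative.inter_mem_NP (toLanguage_univ_mem_NP har) hLc

/-- The same read through the target: if `NoPolyBoundedProofSystem` FAILS then `∃SO` is closed under
complementation on every non-degenerate vocabulary. [cite: Fagin1974, §4] [cite: CookReckhow1979, §1 Prop. 1.1] -/
theorem isESODefinable_compl_of_not_noPolyBoundedProofSystem (hX : ¬ NoPolyBoundedProofSystem)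
    {ar : List ℕ} (har : IsNondegenerateVocab ar) {C : Set (SNPInstance ar)} (hC : IsIsoClosedStr ar C)
    (hdef : IsESODefinable ar C) : IsESODefinable ar Cᶜ := by
  have hNC : Nondeterministic.NP = coNP := by
    by_contra h
    exact hX (noPolyBoundedProofSystem_iff_NP_ne_coNP.2 h)
  exact isESODefinable_compl_of_NP_eq_coNP hNC har hC hdef

/-! ### The bridge into the target -/

/-- **Fagin's programme as a bridge into the target.** One non-degenerate relational vocabulary `ar`
and one isomorphism-closed `∃SO`-definable class `C` of finite `ar`-structures whose complement is
NOT `∃SO`-definable prove `NoPolyBoundedProofSystem` (hence `NP ≠ coNP` and `P ≠ NP`).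
[cite: Fagin1974, §4 (complements of generalized spectra)] [cite: Immerman1999, Cor. 7.9] -/
theorem noPolyBoundedProofSystem_of_not_isESODefinable_compl {ar : List ℕ}
    (har : IsNondegenerateVocab ar) {C : Set (SNPInstance ar)} (hC : IsIsoClosedStr ar C)
    (hdef : IsESODefinable ar C) (hndef : ¬ IsESODefinable ar Cᶜ) : NoPolyBoundedProofSystem :=
  noPolyBoundedProofSystem_iff_NP_ne_coNP.2 fun hNC =>
    hndef (isESODefinable_compl_of_NP_eq_coNP hNC har hC hdef)

/-- Existential packaging of the bridge: "`∃SO ≠ co-∃SO` on some non-degenerate vocabulary" implies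
the target. [cite: Fagin1974, §4] [cite: Immerman1999, Cor. 7.9] -/
theorem noPolyBoundedProofSystem_of_exists_eso_not_closed_compl
    (h : ∃ (ar : List ℕ) (C : Set (SNPInstance ar)), IsNondegenerateVocab ar ∧ IsIsoClosedStr ar C ∧
      IsESODefinable ar C ∧ ¬ IsESODefinable ar Cᶜ) : NoPolyBoundedProofSystem := by
  obtain ⟨ar, C, har, hC, hdef, hndef⟩ := h
  exact noPolyBoundedProofSystem_of_not_isESODefinable_compl har hC hdef hndef

end Summit.PneNP.PneNP.Theorems
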